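import Summits.CriticalPhenomena.PercolationContinuityZ3.Theorems.PercNearOneGluingNoHeavyLowerTailFourPointRelabelExchange
import Summits.CriticalPhenomena.PercolationContinuityZ3.Theorems.PercNearOneGluingNoHeavyLowerTailQ44SingleSourceLawAllN
import HarnessLib

/-!
# Conjecture W up to one top good: `2·B1 + D ≤ (2·P(ab|cy) + 3·P(abcy))·P(a|b|c|y)` on every finite weighted graph

Support file for crux `stmt-CriticalPhenomena-4575` (master-family programme, row `Q44` = Conjecture W of `prim-bnk-1`), seat `prim-l12-p6`
gen 25; memo `run/shared/lean/prim/prim-l12/FROM-prim-l12-p6-g25-W-PENCIL.md` §4b.  Cells `cell w a b c y i` of `FourPointAtoms.pat4`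
(`0 a|b|c|y, 1 a|b|cy, 2 a|by|c, 3 a|bc|y, 4 ay|b|c, 5 ac|b|y, 6 ab|c|y, 7 a|bcy, 8 ay|bc, 9 ac|by, 10 acy|b, 11 ab|cy, 12 aby|c, 13 abc|y, 14 abcy`);
`B1 = c₁₁c₉ + c₁₁c₈ + c₆c₈ + c₆c₁ + c₁c₈`, darts `D = c₂c₁₃ + c₁c₁₃ + c₅c₁₂ + c₁c₁₂ + c₆c₁₀ + c₆c₇ + c₂c₁₀ + c₅c₇`; Conjecture W
(`TwoCopyMono.kerQ44`, open for all `n`) is `2·B1 + D ≤ 2(c₁₁ + c₁₄)c₀`.  PROVED HERE for every finite weighted graph on `Fin n`: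
`Q44TopGood.wPlus_cells : 2·B1 + D ≤ (2c₁₁ + 3c₁₄)·c₀` — W up to ONE extra copy of the good `P(abcy)P(∅)`.  The constant is optimal for
degree-2 certificates over the memo's law-level dictionary (Harris, BHK 2006 Thms 1.1/2.1 with sets, Gladkov's strong-FKG sunflower rows, the
kernel rows `Q44b`/SS7 and the single-product atlas, all relabelings): `(2+λ)c₁₄` is certifiable iff `λ ≥ 1` (kit j202734), and W itself has an
exact pseudo-law relative to that dictionary (kit j202363).  Certificate (exact, denominators 2, verified symbolically):
`W + c₀c₁₄ = A′ + ½(D′ + D″) + ½ Σ_{σ ∈ {acby, bacy, caby, ycab}} Q44b∘σ + ½(SS7∘bayc + SS7∘ycba) + R`,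
`A′ : c₀c₉ ≤ c₂c₅`, `D′ : c₁c₈ ≤ c₄c₇`, `D″ : c₆c₈ ≤ c₃c₁₂` (the exchange rows `Q44TopGood.exch_*` of `…FourPointRelabelExchange`, instances of
the two-set exchange `setTwoClusterExchange`, BHK 2006 Thm 2.1 at `q = 1`), `Q44b∘σ = TwoCopyMono.q44b_pack_nine`,
`SS7∘σ = SingleSourceLaw.pack_singleSource` on the relabelled quadruple, `R = ½c₁c₉ + ½c₃c₁₀ + ½c₄c₁₃ + c₅c₈ + c₅c₁₁ + ½c₆c₉ + c₈c₉ + c₉c₁₁`.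
Relabelled cells via `Q44TopGood.cell_relabel_*` (`…FourPointRelabelExchange`).  No named facts, no sorries, no definitions; standard axioms.
-/

noncomputable section

namespace Summit.CriticalPhenomena.PercolationContinuityZ3.Theorems

namespace Q44TopGood

open MeasureTheory Set Literature.Probability.Percolation
open Literature.Probability.LatticeModels (prodBernoulli)
open FourPointAtoms
open Summit.CriticalPhenomena.PercolationContinuityZ3.Cruxes.AdditiveGluing.TieLine.ConnAtoms
open scoped Classical

variable {n : ℕ}

/-! ## The kernel rows `Q44b`, SS7 and type A for relabelled quadruples, in the cells of `(a,b,c,y)` -/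

/-- `q44b_pack_nine` for the quadruple `(a c b y)`, rewritten in the cells of `(a,b,c,y)`. [this work] -/
theorem q44b_acby (w : Sym2 (Fin n) → unitInterval) (a b c y : Fin n) :
    cell w a b c y 2 * cell w a b c y 5 + cell w a b c y 4 * cell w a b c y 7 + cell w a b c y 5 * cell w a b c y 7 + cell w a b c y 5 * cell w a b c y 8 + cell w a b c y 5 * cell w a b c y 11 + cell w a b c y 5 * cell w a b c y 12 + cell w a b c y 6 * cell w a b c y 7 + cell w a b c y 8 * cell w a b c y 9 + cell w a b c y 9 * cell w a b c y 11 ≤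
      cell w a b c y 0 * cell w a b c y 9 + cell w a b c y 0 * cell w a b c y 14 := by
  have h := TwoCopyMono.q44b_pack_nine w a c b y
  rw [cell_relabel_acby w a b c y 11, cell_relabel_acby w a b c y 9, cell_relabel_acby w a b c y 8, cell_relabel_acby w a b c y 6, cell_relabel_acby w a b c y 1, cell_relabel_acby w a b c y 10, cell_relabel_acby w a b c y 7, cell_relabel_acby w a b c y 5, cell_relabel_acby w a b c y 4, cell_relabel_acby w a b c y 14, cell_relabel_acby w a b c y 0] at h
  simp (config := {decide := true}) only [ite_true, ite_false, zero_add, add_zero] at h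
  linarith

/-- `q44b_pack_nine` for the quadruple `(b a c y)`, rewritten in the cells of `(a,b,c,y)`. [this work] -/
theorem q44b_bacy (w : Sym2 (Fin n) → unitInterval) (a b c y : Fin n) :
    cell w a b c y 1 * cell w a b c y 6 + cell w a b c y 2 * cell w a b c y 10 + cell w a b c y 3 * cell w a b c y 10 + cell w a b c y 6 * cell w a b c y 7 + cell w a b c y 6 * cell w a b c y 8 + cell w a b c y 6 * cell w a b c y 9 + cell w a b c y 6 * cell w a b c y 10 + cell w a b c y 8 * cell w a b c y 11 + cell w a b c y 9 * cell w a b c y 11 ≤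
      cell w a b c y 0 * cell w a b c y 11 + cell w a b c y 0 * cell w a b c y 14 := by
  have h := TwoCopyMono.q44b_pack_nine w b a c y
  rw [cell_relabel_bacy w a b c y 11, cell_relabel_bacy w a b c y 9, cell_relabel_bacy w a b c y 8, cell_relabel_bacy w a b c y 6, cell_relabel_bacy w a b c y 1, cell_relabel_bacy w a b c y 10, cell_relabel_bacy w a b c y 7, cell_relabel_bacy w a b c y 5, cell_relabel_bacy w a b c y 4, cell_relabel_bacy w a b c y 14, cell_relabel_bacy w a b c y 0] at h
  simp (config := {decide := true}) only [ite_true, ite_false, zero_add, add_zero] at h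
  linarith

/-- `q44b_pack_nine` for the quadruple `(c a b y)`, rewritten in the cells of `(a,b,c,y)`. [this work] -/
theorem q44b_caby (w : Sym2 (Fin n) → unitInterval) (a b c y : Fin n) :
    cell w a b c y 1 * cell w a b c y 12 + cell w a b c y 2 * cell w a b c y 5 + cell w a b c y 3 * cell w a b c y 12 + cell w a b c y 5 * cell w a b c y 7 + cell w a b c y 5 * cell w a b c y 8 + cell w a b c y 5 * cell w a b c y 11 + cell w a b c y 5 * cell w a b c y 12 + cell w a b c y 8 * cell w a b c y 9 + cell w a b c y 9 * cell w a b c y 11 ≤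
      cell w a b c y 0 * cell w a b c y 9 + cell w a b c y 0 * cell w a b c y 14 := by
  have h := TwoCopyMono.q44b_pack_nine w c a b y
  rw [cell_relabel_caby w a b c y 11, cell_relabel_caby w a b c y 9, cell_relabel_caby w a b c y 8, cell_relabel_caby w a b c y 6, cell_relabel_caby w a b c y 1, cell_relabel_caby w a b c y 10, cell_relabel_caby w a b c y 7, cell_relabel_caby w a b c y 5, cell_relabel_caby w a b c y 4, cell_relabel_caby w a b c y 14, cell_relabel_caby w a b c y 0] at h
  simp (config := {decide := true}) only [ite_true, ite_false, zero_add, add_zero] at h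
  linarith

/-- `q44b_pack_nine` for the quadruple `(y c a b)`, rewritten in the cells of `(a,b,c,y)`. [this work] -/
theorem q44b_ycab (w : Sym2 (Fin n) → unitInterval) (a b c y : Fin n) :
    cell w a b c y 1 * cell w a b c y 6 + cell w a b c y 1 * cell w a b c y 8 + cell w a b c y 1 * cell w a b c y 9 + cell w a b c y 1 * cell w a b c y 12 + cell w a b c y 1 * cell w a b c y 13 + cell w a b c y 2 * cell w a b c y 13 + cell w a b c y 4 * cell w a b c y 13 + cell w a b c y 8 * cell w a b c y 11 + cell w a b c y 9 * cell w a b c y 11 ≤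
      cell w a b c y 0 * cell w a b c y 11 + cell w a b c y 0 * cell w a b c y 14 := by
  have h := TwoCopyMono.q44b_pack_nine w y c a b
  rw [cell_relabel_ycab w a b c y 11, cell_relabel_ycab w a b c y 9, cell_relabel_ycab w a b c y 8, cell_relabel_ycab w a b c y 6, cell_relabel_ycab w a b c y 1, cell_relabel_ycab w a b c y 10, cell_relabel_ycab w a b c y 7, cell_relabel_ycab w a b c y 5, cell_relabel_ycab w a b c y 4, cell_relabel_ycab w a b c y 14, cell_relabel_ycab w a b c y 0] at h
  simp (config := {decide := true}) only [ite_true, ite_false, zero_add, add_zero] at h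
  linarith

/-- `pack_singleSource` for the quadruple `(b a y c)`, rewritten in the cells of `(a,b,c,y)`. [this work] -/
theorem ss7_bayc (w : Sym2 (Fin n) → unitInterval) (a b c y : Fin n) :
    cell w a b c y 1 * cell w a b c y 6 + cell w a b c y 1 * cell w a b c y 8 + cell w a b c y 2 * cell w a b c y 10 + cell w a b c y 6 * cell w a b c y 8 + cell w a b c y 6 * cell w a b c y 10 + cell w a b c y 8 * cell w a b c y 11 + cell w a b c y 9 * cell w a b c y 11 ≤
      cell w a b c y 0 * cell w a b c y 11 + cell w a b c y 0 * cell w a b c y 14 := by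
  have h := SingleSourceLaw.pack_singleSource w b a y c
  rw [cell_relabel_bayc w a b c y 6, cell_relabel_bayc w a b c y 7, cell_relabel_bayc w a b c y 5, cell_relabel_bayc w a b c y 11, cell_relabel_bayc w a b c y 9, cell_relabel_bayc w a b c y 8, cell_relabel_bayc w a b c y 1, cell_relabel_bayc w a b c y 14, cell_relabel_bayc w a b c y 0] at h
  simp (config := {decide := true}) only [ite_true, ite_false, zero_add, add_zero] at h
  linarith

/-- `pack_singleSource` for the quadruple `(y c b a)`, rewritten in the cells of `(a,b,c,y)`. [this work] -/
theorem ss7_ycba (w : Sym2 (Fin n) → unitInterval) (a b c y : Fin n) :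
    cell w a b c y 1 * cell w a b c y 6 + cell w a b c y 1 * cell w a b c y 8 + cell w a b c y 1 * cell w a b c y 13 + cell w a b c y 2 * cell w a b c y 13 + cell w a b c y 6 * cell w a b c y 8 + cell w a b c y 8 * cell w a b c y 11 + cell w a b c y 9 * cell w a b c y 11 ≤
      cell w a b c y 0 * cell w a b c y 11 + cell w a b c y 0 * cell w a b c y 14 := by
  have h := SingleSourceLaw.pack_singleSource w y c b a
  rw [cell_relabel_ycba w a b c y 6, cell_relabel_ycba w a b c y 7, cell_relabel_ycba w a b c y 5, cell_relabel_ycba w a b c y 11, cell_relabel_ycba w a b c y 9, cell_relabel_ycba w a b c y 8, cell_relabel_ycba w a b c y 1, cell_relabel_ycba w a b c y 14, cell_relabel_ycba w a b c y 0] at h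
  simp (config := {decide := true}) only [ite_true, ite_false, zero_add, add_zero] at h
  linarith

/-! ## The theorem -/

/-- **Conjecture W up to one top good** (all `n`, all marked points): with `B1 = c₁₁c₉ + c₁₁c₈ + c₆c₈ + c₆c₁ + c₁c₈` and the darts
`D = c₂c₁₃ + c₁c₁₃ + c₅c₁₂ + c₁c₁₂ + c₆c₁₀ + c₆c₇ + c₂c₁₀ + c₅c₇`:  `2·B1 + D ≤ (2·c₁₁ + 3·c₁₄)·c₀`, i.e.
`2·B1 + D ≤ 2[P(ab|cy)+P(abcy)]·P(a|b|c|y) + P(abcy)·P(a|b|c|y)` (Conjecture W is the same without the last term). [this work] -/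
theorem wPlus_cells (w : Sym2 (Fin n) → unitInterval) (a b c y : Fin n) :
    2 * (cell w a b c y 11 * cell w a b c y 9 + cell w a b c y 11 * cell w a b c y 8 + cell w a b c y 6 * cell w a b c y 8 +
          cell w a b c y 6 * cell w a b c y 1 + cell w a b c y 1 * cell w a b c y 8) +
        (cell w a b c y 2 * cell w a b c y 13 + cell w a b c y 1 * cell w a b c y 13 + cell w a b c y 5 * cell w a b c y 12 +
          cell w a b c y 1 * cell w a b c y 12 + cell w a b c y 6 * cell w a b c y 10 + cell w a b c y 6 * cell w a b c y 7 +
          cell w a b c y 2 * cell w a b c y 10 + cell w a b c y 5 * cell w a b c y 7) ≤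
      (2 * cell w a b c y 11 + 3 * cell w a b c y 14) * cell w a b c y 0 := by
  have hA := exch_c0c9_le_c2c5 w a b c y
  have hD1 := exch_c1c8_le_c4c7 w a b c y
  have hD2 := exch_c6c8_le_c3c12 w a b c y
  have h1 := q44b_acby w a b c y
  have h2 := q44b_bacy w a b c y
  have h3 := q44b_caby w a b c y
  have h4 := q44b_ycab w a b c y
  have h5 := ss7_bayc w a b c y
  have h6 := ss7_ycba w a b c y
  have r19 := mul_nonneg (cell_nonneg w a b c y 1) (cell_nonneg w a b c y 9)
  have r310 := mul_nonneg (cell_nonneg w a b c y 3) (cell_nonneg w a b c y 10)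
  have r413 := mul_nonneg (cell_nonneg w a b c y 4) (cell_nonneg w a b c y 13)
  have r58 := mul_nonneg (cell_nonneg w a b c y 5) (cell_nonneg w a b c y 8)
  have r511 := mul_nonneg (cell_nonneg w a b c y 5) (cell_nonneg w a b c y 11)
  have r69 := mul_nonneg (cell_nonneg w a b c y 6) (cell_nonneg w a b c y 9)
  have r89 := mul_nonneg (cell_nonneg w a b c y 8) (cell_nonneg w a b c y 9)
  have r911 := mul_nonneg (cell_nonneg w a b c y 9) (cell_nonneg w a b c y 11)
  linear_combination hA + (1/2 : ℝ) * hD1 + (1/2 : ℝ) * hD2 + (1/2 : ℝ) * h1 + (1/2 : ℝ) * h2 + (1/2 : ℝ) * h3 +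
    (1/2 : ℝ) * h4 + (1/2 : ℝ) * h5 + (1/2 : ℝ) * h6 + (1/2 : ℝ) * r19 + (1/2 : ℝ) * r310 + (1/2 : ℝ) * r413 + r58 + r511 +
    (1/2 : ℝ) * r69 + r89 + r911

end Q44TopGood

end Summit.CriticalPhenomena.PercolationContinuityZ3.Theorems
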